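import Mathlib
import HarnessLib
import Summits.HubbardSuperconductivity.HubbardSuperconductivity.Theorems.KLProgrammeKLRegimeEngineScaleZeroE4OverlapTime

/-!
# K3 engine child, stub `stub_engine_scale0`, clause (E4)₀: the TIME MOMENT `T_T` of the scale-`0` multiplier kernels, part 2 —
# the scale-`0` family on an admissible frame: `T_T ≤ C_T · M/β`

Cell `gate-hubbard-kl`, seat p4 (C5a lead; multiplier lane), g8.  Instantiation of part 1's `timeTorusSum_le_of_symbol_bounds` on
`F = klAnisoFamily … klE0 0` (padded symbol `= bgmGridSymbol`, `scaleZeroPadded_eq_bgmGridSymbol`): support `N_s ≤ (klE0β/π + 1)(1793·klE0·L² + 704·L)`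
(`card_support_scaleZeroPadded_le`, `card_freqWindow_mul_shell_le_of_frameOK`), SIXTH time differences `≤ (2π/β)⁶·720·B·(2/klE0)⁶`
(`norm_fwdDiff_iter_time_bgmGridSymbol_prod_le` under `klE0·β ≤ π(2M−13)`, `B` the unit-profile bound of order `6`), axis second differences with
k3c2-p1's frame geometry of `…ScaleZeroExplicit` (`s₁ = 2/(π(C_s⋆+1))`), and the time rate `s₀ = klE0·β/(π·4M)` — at which
`(s₀·4M/4)·(2π/β)·(2/klE0) = 1`, so every `β` of the time differences cancels.  Result, with `4 ≤ 4M/β` (`β ≤ M`) and `klE0·β ≥ π`: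

* **`timeMoment_klAnisoFamily_zero_le_explicit`** — for every `ω`, `c`:
  `(|β|L²)⁻¹ Σ_{dw} (β/4M)·cyclicDist(dw.1 0, 0)·‖Σ_k F_ω(k) Χ_c(k;dw)‖ ≤ klTimeMomentC B · M/β`, where `klTimeMomentC B` is the closed real
  `128π(2 + 6π(C_s⋆+1))·√((1 + 64π²)(1793/32 + 704)·7(1 + (720B)²)/(16π))` written INLINE (no definition);
* **`exists_timeMomentConst_klAnisoFamily_zero`** — `∃ C_T ≥ 0` (absolute), same statement: the `T_T` input of k3c2-p1's hT.

Everything is proved; no definitions, no named facts, no sorry. [cite: BenfattoGiulianiMastropietro2006, Lemma 2.2 (2.36aa), §2.8 (2.81), (3.3)]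
-/

noncomputable section

namespace Summit.HubbardSuperconductivity.HubbardSuperconductivity.Theorems.EngineV8

set_option linter.dupNamespace false -- summit = problem name (single-conjunct summit), D-0017

open Real Finset Literature.MathematicalPhysics.QuantumLattice Literature.Probability.LatticeModels
open Summit.HubbardSuperconductivity.HubbardSuperconductivity.Theorems.KLRegimeSplit
open Summit.HubbardSuperconductivity.HubbardSuperconductivity.Theorems.KLProgrammeLegKernels
open Summit.HubbardSuperconductivity.HubbardSuperconductivity.Theorems.ScaleZeroDecay
open scoped ComplexConjugate Nat

variable {L M : ℕ} [NeZero L]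

/-- `x ≤ (x + 1)²` for `x ≥ 0`. -/
theorem le_add_one_sq_of_nonneg {x : ℝ} (hx : 0 ≤ x) : x ≤ (x + 1) ^ 2 := by nlinarith

set_option maxHeartbeats 400000 in
-- the frame-geometry discharge of the axis differences plus the final algebra is long
/-- **The time moment of the scale-`0` multiplier kernels on an admissible frame** (see the module docstring): with `B ≥ 1` bounding the
unit-profile derivatives of orders `≤ 6`, for every sector `ω` and charge `c`,
`(|β|L²)⁻¹ Σ_{dw} (β/4M)·cyclicDist(dw.1 0, 0)·‖Σ_k F_ω(k) Χ_c(k;dw)‖ ≤ 128π(2 + 6π(C_s⋆+1))·√((1+64π²)(1793/32+704)·7(1+(720B)²)/(16π)) · M/β`.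
[cite: BenfattoGiulianiMastropietro2006, Lemma 2.2 (2.36aa) and (3.3)] -/
theorem timeMoment_klAnisoFamily_zero_le_explicit [NeZero M] {R : RenConsts} {U : ℝ} {N : ℕ} {μ : ℝ} {K : TrigPolyC4v}
    (hK : FrameOK R U N μ K) (hR : ∀ j, 0 ≤ R.Gfr j) (hμ : μ ∈ klWindowC) (hκU : 16 / 15 * (R.Gfr 0 * |U|) ≤ 1 / 50)
    (hL : (2 : ℝ) ^ 15 ≤ L) {β : ℝ} (hβ : klBetaMin ≤ β) (hβM : β ≤ M)
    (hMβ : klE0 * β ≤ Real.pi * (2 * M - 13)) {B : ℝ} (hB1 : 1 ≤ B)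
    (hB : ∀ i ≤ 6, ∀ u, ‖iteratedDeriv i (bgmCutoffSqUnit klE0) u‖ ≤ B) (ω : Fin (sectorCount 0)) (c : Fin 2) :
    1 / (|β| * (L : ℝ) ^ 2) *
        ∑ dw : TorusSite 1 (2 * (2 * M)) × TorusSite 2 L,
          (β / (2 * (2 * M) : ℕ) * cyclicDist (2 * (2 * M)) (dw.1 0) 0) *
            ‖∑ k : FreqMomentum L M, klAnisoFamily L M β μ K klE0 0 ω k *
              (if c = 0 then torusChar (fun _ : Fin 1 => ((k.1 : ℕ) : ZMod (2 * (2 * M)))) dw.1 * torusChar k.2 dw.2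
                else conj (torusChar (fun _ : Fin 1 => ((k.1 : ℕ) : ZMod (2 * (2 * M)))) dw.1 * torusChar k.2 dw.2))‖ ≤
      (128 * Real.pi * (2 + 6 * Real.pi * ((22484224 / 9 + 7180 / 3 * sectorCircLineConst) + 1)) *
        Real.sqrt ((1 + 64 * Real.pi ^ 2) * (1793 / 32 + 704) * (7 * (1 + (720 * B) ^ 2)) / (16 * Real.pi))) * (M / β) := by
  classical
  -- elementary sizes
  have he : (0 : ℝ) < klE0 := by norm_num [klE0]
  have hE : klE0 = 1 / 32 := by norm_num [klE0]
  have hβpos : 0 < β := lt_of_lt_of_le (by norm_num [klBetaMin]) hβ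
  have hβ128 : (128 : ℝ) ≤ β := le_trans (by norm_num [klBetaMin]) hβ
  have hLpos : (0 : ℝ) < L := lt_of_lt_of_le (by norm_num) hL
  have hL1 : (1 : ℝ) ≤ L := le_trans (by norm_num) hL
  have hMr : (128 : ℝ) ≤ M := hβ128.trans hβM
  have hMpos : (0 : ℝ) < M := by linarith
  have hM2 : 2 ≤ M := by
    have : (2 : ℝ) ≤ M := by linarith
    exact_mod_cast this
  have hπ := Real.pi_pos
  have hπ3 : (3 : ℝ) < Real.pi := Real.pi_gt_three
  have hπ4 : Real.pi < 3.1416 := Real.pi_lt_d4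
  have hB0 : 0 ≤ B := zero_le_one.trans hB1
  have hBc := sectorCircLineConst_nonneg
  have hCs : 0 ≤ (22484224 / 9 + 7180 / 3 * sectorCircLineConst) := by positivity
  obtain ⟨hμ1, hμ2⟩ := hμ
  haveI : NeZero (2 * (2 * M)) := ⟨by have := NeZero.ne M; omega⟩
  have hNg : (((2 * (2 * M) : ℕ) : ℝ)) = 4 * M := by push_cast; ring
  have hNgpos : (0 : ℝ) < ((2 * (2 * M) : ℕ) : ℝ) := by rw [hNg]; positivity
  have hMN : 2 * M ≤ 2 * (2 * M) := by omega
  -- thresholds in the forms the symbol lemmas want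
  have hMβ3 : klE0 * β ≤ Real.pi * (2 * M - 3) := hMβ.trans (by nlinarith)
  have hMβ' : klE0 * β ≤ Real.pi * (2 * M + 1) := hMβ.trans (by nlinarith)
  -- the rates
  set s₀ : ℝ := klE0 * β / (Real.pi * ((2 * (2 * M) : ℕ) : ℝ)) with hs₀
  set s₁ : ℝ := 2 / (Real.pi * ((22484224 / 9 + 7180 / 3 * sectorCircLineConst) + 1)) with hs₁
  have hs₀pos : 0 < s₀ := by rw [hs₀]; positivity
  have hs₁pos : 0 < s₁ := by rw [hs₁]; positivity
  -- (hsupp)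
  have hsupp := fun ω : Fin (sectorCount 0) => card_support_scaleZeroPadded_le (L := L) hβpos hMβ' μ K ω
  set Nsupp : ℕ := (((univ : Finset (TorusSite 1 (2 * (2 * M)))).filter (fun q₁ => |gridFreq M (2 * (2 * M)) β q₁| < klE0)) ×ˢ
    ((univ : Finset (TorusSite 2 L)).filter (fun k => |nambuXiCT L μ K k| < klE0))).card with hNs
  have hNsupp : (Nsupp : ℝ) ≤ (klE0 * β / Real.pi + 1) * (1793 * klE0 * (L : ℝ) ^ 2 + 704 * L) :=
    card_freqWindow_mul_shell_le_of_frameOK hK hβpos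
  -- (h₆) sixth time differences
  set A₆ : ℝ := (2 * Real.pi / β) ^ 6 * ((6 : ℕ) ! * B * (2 / klE0) ^ 6) with hA₆
  have h₆ : ∀ (ω : Fin (sectorCount 0)) (q : TorusSite 1 (2 * (2 * M)) × TorusSite 2 L),
      ‖(fwdDiff ((fun _ : Fin 1 => (1 : ZMod (2 * (2 * M)))), (0 : TorusSite 2 L)))^[6]
        (fun q : TorusSite 1 (2 * (2 * M)) × TorusSite 2 L =>
          if h : (q.1 0).val < 2 * M then klAnisoFamily L M β μ K klE0 0 ω (⟨(q.1 0).val, h⟩, q.2) else 0) q‖ ≤ A₆ := by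
    intro ω q
    rw [scaleZeroPadded_eq_bgmGridSymbol]
    have hM6 : klE0 * β ≤ Real.pi * (2 * M - 2 * (6 : ℕ) - 1) := by push_cast; linarith
    exact norm_fwdDiff_iter_time_bgmGridSymbol_prod_le he hβpos hMN hM6 hB1 hB le_rfl μ K ω q
  -- (h₁) axis second differences with the frame geometry (k3c2-p1's discharge)
  have hKκ : ∀ q : Fin 2 → ℝ, |K.eval q| ≤ 16 / 15 * (R.Gfr 0 * |U|) := abs_eval_le_of_frameOK hK hR
  have h4πL : 4 * Real.pi / L ≤ 1 / 2 ^ 11 := by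
    rw [div_le_iff₀ hLpos]
    have : (4 : ℝ) * Real.pi ≤ 2 ^ 4 := by linarith
    calc 4 * Real.pi ≤ 2 ^ 4 := this
      _ = 1 / 2 ^ 11 * 2 ^ 15 := by norm_num
      _ ≤ 1 / 2 ^ 11 * L := by gcongr
  have hL8 : 8 < L := by
    have : (8 : ℝ) < L := lt_of_lt_of_le (by norm_num) hL
    exact_mod_cast this
  have hL8' : 8 ≤ L := hL8.le
  have hzone : ∀ (l : Fin 2) (k : TorusSite 2 L), |2 * (((k l).val : ℤ)) - L| ≤ 4 → klE0 ≤ |nambuXiCT L μ K k| := by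
    intro l k hk
    refine le_abs_nambuXiCT_of_boundary hL8' hKκ ?_ l k hk
    have hcos : 1 - (4 * Real.pi / L) ^ 2 / 2 ≤ Real.cos (4 * Real.pi / L) := Real.one_sub_sq_div_two_le_cos
    have hsmall : (4 * Real.pi / L) ^ 2 ≤ (1 / 2 ^ 11) ^ 2 := pow_le_pow_left₀ (by positivity) h4πL 2
    rw [hE]
    norm_num at hsmall ⊢
    nlinarith [hcos, hsmall, hμ2, hκU]
  have hr : ∀ k : TorusSite 2 L, |nambuXiCT L μ K k| < klE0 → (17 / 10 : ℝ) ≤ ‖momToComplex (torusCentredMomentum L k)‖ := by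
    intro k hk
    refine le_norm_centred_of_abs_nambuXiCT_lt hKκ ?_ k hk
    rw [hE]
    norm_num
    linarith [hμ1, hκU]
  have hr₁ : 4 * Real.pi / L < 17 / 10 := lt_of_le_of_lt h4πL (by norm_num)
  have hx : 3 / (17 / 10 - 4 * Real.pi / L) ≤ 2 := by
    rw [div_le_iff₀ (by linarith)]
    have : 4 * Real.pi / L ≤ 1 / 2 ^ 11 := h4πL
    linarith
  have hx0 : 0 ≤ 3 / (17 / 10 - 4 * Real.pi / L) := by
    have : 0 < 17 / 10 - 4 * Real.pi / L := by linarith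
    positivity
  have hD := uvLineBound_of_frameOK hK
  have h₁ : ∀ (ω : Fin (sectorCount 0)) (q : TorusSite 1 (2 * (2 * M)) × TorusSite 2 L) (i : Fin 2),
      ‖(fwdDiff ((0 : TorusSite 1 (2 * (2 * M))), (Pi.single i (1 : ZMod L) : TorusSite 2 L)))^[2]
        (fun q : TorusSite 1 (2 * (2 * M)) × TorusSite 2 L =>
          if h : (q.1 0).val < 2 * M then klAnisoFamily L M β μ K klE0 0 ω (⟨(q.1 0).val, h⟩, q.2) else 0) q‖ ≤ (4 / (s₁ * L)) ^ 2 := by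
    intro ω q i
    rw [scaleZeroPadded_eq_bgmGridSymbol]
    refine (norm_fwdDiff_two_space_bgmGridSymbol_prod_le (M := M) (N := 2 * (2 * M)) (β := β) he hL8 hD i (hzone i) hr hr₁ ω q).trans ?_
    set x : ℝ := 3 / (17 / 10 - 4 * Real.pi / L) with hxdef
    have hCsL : 448 / (9 * klE0 ^ 2) * 7 ^ 2 + 8 / (3 * klE0) * 7 + 2 * (8 / (3 * klE0) * 7) * (sectorCircLineConst * x) +
        sectorCircLineConst * x ^ 2 ≤ (22484224 / 9 + 7180 / 3 * sectorCircLineConst) := by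
      have h1 : sectorCircLineConst * x ≤ sectorCircLineConst * 2 := mul_le_mul_of_nonneg_left hx hBc
      have h2 : sectorCircLineConst * x ^ 2 ≤ sectorCircLineConst * 2 ^ 2 :=
        mul_le_mul_of_nonneg_left (pow_le_pow_left₀ hx0 hx 2) hBc
      rw [hE]
      norm_num
      nlinarith [h1, h2, hBc]
    have hval : (4 / (s₁ * L)) ^ 2 = (2 * Real.pi / L) ^ 2 * ((22484224 / 9 + 7180 / 3 * sectorCircLineConst) + 1) ^ 2 := by
      rw [hs₁]
      field_simp
      ring
    rw [hval]
    exact mul_le_mul_of_nonneg_left (hCsL.trans (le_add_one_sq_of_nonneg hCs)) (by positivity)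
  -- the abstract bound
  have hT := timeTorusSum_le_of_symbol_bounds hβpos (klAnisoFamily L M β μ K klE0 0) (conj_klAnisoFamily β μ K klE0 0)
    (fun ω k => norm_bgmMultiplier_le_one klE0 β _ 0 ω k) hs₀pos hs₁pos hsupp h₆ h₁ ω c
  refine hT.trans ?_
  clear hT h₆ h₁ hsupp hzone hr hD hKκ hx hx0 hr₁ h4πL
  -- simplify: `(β/(Ng s₀))² = (π/klE0)²`, `(s₀Ng/4)¹²A₆² = (720B)²`
  have hβNs : β / (((2 * (2 * M) : ℕ) : ℝ) * s₀) = Real.pi / klE0 := by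
    rw [hs₀]; field_simp
  have hA : (s₀ * ((2 * (2 * M) : ℕ) : ℝ) / 4) ^ 12 * A₆ ^ 2 = (720 * B) ^ 2 := by
    have hfact : ((6 : ℕ) ! : ℝ) = 720 := by norm_num [Nat.factorial]
    rw [hA₆, hfact]
    have h1 : (s₀ * ((2 * (2 * M) : ℕ) : ℝ) / 4) ^ 12 = ((s₀ * ((2 * (2 * M) : ℕ) : ℝ) / 4) ^ 6) ^ 2 := by ring
    have h2 : (s₀ * ((2 * (2 * M) : ℕ) : ℝ) / 4) ^ 6 * ((2 * Real.pi / β) ^ 6 * (2 / klE0) ^ 6) = 1 := by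
      rw [← mul_pow, ← mul_pow]
      have : s₀ * ((2 * (2 * M) : ℕ) : ℝ) / 4 * (2 * Real.pi / β * (2 / klE0)) = 1 := by
        rw [hs₀]; field_simp; ring
      rw [this, one_pow]
    calc (s₀ * ((2 * (2 * M) : ℕ) : ℝ) / 4) ^ 12 * ((2 * Real.pi / β) ^ 6 * (720 * B * (2 / klE0) ^ 6)) ^ 2
        = ((s₀ * ((2 * (2 * M) : ℕ) : ℝ) / 4) ^ 6 * ((2 * Real.pi / β) ^ 6 * (2 / klE0) ^ 6)) ^ 2 * (720 * B) ^ 2 := by ring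
      _ = (720 * B) ^ 2 := by rw [h2, one_pow, one_mul]
  have hA' : (7 : ℝ) + 7 * (s₀ * ((2 * (2 * M) : ℕ) : ℝ) / 4) ^ 12 * A₆ ^ 2 = 7 * (1 + (720 * B) ^ 2) := by
    rw [mul_assoc, hA]; ring
  rw [hβNs, hA']
  -- the two growing factors: `4 + 2π/s₀ ≤ (1 + 64π²)·Ng/β` and `N_s ≤ (β/(16π))(1793/32 + 704) L²`
  have hNgβ : 4 ≤ ((2 * (2 * M) : ℕ) : ℝ) / β := by
    rw [hNg, le_div_iff₀ hβpos]; linarith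
  have hgrow : 4 + 2 * Real.pi / s₀ ≤ (1 + 64 * Real.pi ^ 2) * (((2 * (2 * M) : ℕ) : ℝ) / β) := by
    have h1 : 2 * Real.pi / s₀ = 64 * Real.pi ^ 2 * (((2 * (2 * M) : ℕ) : ℝ) / β) := by
      rw [hs₀, hE]; field_simp; ring
    rw [h1, add_mul, one_mul]
    linarith [hNgβ]
  have hNs' : (Nsupp : ℝ) ≤ β / (16 * Real.pi) * (1793 / 32 + 704) * (L : ℝ) ^ 2 := by
    refine hNsupp.trans ?_
    have h1 : klE0 * β / Real.pi + 1 ≤ 2 * (klE0 * β / Real.pi) := by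
      rw [hE]
      have : 1 ≤ 1 / 32 * β / Real.pi := by rw [le_div_iff₀ hπ]; linarith
      linarith
    have hLsq : (L : ℝ) ≤ (L : ℝ) ^ 2 := by rw [sq]; exact le_mul_of_one_le_left hLpos.le hL1
    have h2 : 1793 * klE0 * (L : ℝ) ^ 2 + 704 * L ≤ (1793 * klE0 + 704) * (L : ℝ) ^ 2 := by
      rw [add_mul]; linarith [hLsq]
    calc (klE0 * β / Real.pi + 1) * (1793 * klE0 * (L : ℝ) ^ 2 + 704 * L)
        ≤ (2 * (klE0 * β / Real.pi)) * ((1793 * klE0 + 704) * (L : ℝ) ^ 2) := mul_le_mul h1 h2 (by positivity) (by positivity)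
      _ = β / (16 * Real.pi) * (1793 / 32 + 704) * (L : ℝ) ^ 2 := by rw [hE]; ring
  -- assemble: `(1/(βL²))·√a·√b ≤ C·M/β` via `ab ≤ (C M L²)²`
  set Cst : ℝ := 128 * Real.pi * (2 + 6 * Real.pi * ((22484224 / 9 + 7180 / 3 * sectorCircLineConst) + 1)) *
    Real.sqrt ((1 + 64 * Real.pi ^ 2) * (1793 / 32 + 704) * (7 * (1 + (720 * B) ^ 2)) / (16 * Real.pi)) with hCst
  have hCst0 : 0 ≤ Cst := by rw [hCst]; positivity
  have hs₁val : 2 + 12 / s₁ = 2 + 6 * Real.pi * ((22484224 / 9 + 7180 / 3 * sectorCircLineConst) + 1) := by rw [hs₁]; field_simp; ring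
  set a : ℝ := (Real.pi / klE0) ^ 2 * ((4 + 2 * Real.pi / s₀) * (2 + 12 / s₁) ^ 2) with ha
  set b : ℝ := ((2 * (2 * M) : ℕ) : ℝ) * (L : ℝ) ^ 2 * (Nsupp * (7 * (1 + (720 * B) ^ 2))) with hb
  have ha0 : 0 ≤ a := by positivity
  have hb0 : 0 ≤ b := by positivity
  have hab : a * b ≤ (Cst * M * (L : ℝ) ^ 2) ^ 2 := by
    have hK : (Cst * M * (L : ℝ) ^ 2) ^ 2 = (32 * Real.pi) ^ 2 * (2 + 12 / s₁) ^ 2 *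
        ((1 + 64 * Real.pi ^ 2) * (1793 / 32 + 704) * (7 * (1 + (720 * B) ^ 2)) / (16 * Real.pi)) * (4 * M) ^ 2 * (L : ℝ) ^ 4 := by
      rw [hCst, hs₁val, mul_pow, mul_pow, mul_pow, Real.sq_sqrt (by positivity)]
      ring
    rw [hK, ha, hb, hE]
    have hπk : (Real.pi / (1 / 32 : ℝ)) ^ 2 = (32 * Real.pi) ^ 2 := by congr 1; field_simp
    rw [hπk]
    -- use `hgrow` and `hNs'`
    have h1 : (4 + 2 * Real.pi / s₀) * (((2 * (2 * M) : ℕ) : ℝ) * (Nsupp : ℝ)) ≤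
        (1 + 64 * Real.pi ^ 2) * (((2 * (2 * M) : ℕ) : ℝ) / β) * (((2 * (2 * M) : ℕ) : ℝ) * (β / (16 * Real.pi) * (1793 / 32 + 704) * (L : ℝ) ^ 2)) :=
      mul_le_mul hgrow (mul_le_mul_of_nonneg_left hNs' hNgpos.le) (by positivity) (by positivity)
    have h2 : (1 + 64 * Real.pi ^ 2) * (((2 * (2 * M) : ℕ) : ℝ) / β) * (((2 * (2 * M) : ℕ) : ℝ) * (β / (16 * Real.pi) * (1793 / 32 + 704) * (L : ℝ) ^ 2)) =
        (1 + 64 * Real.pi ^ 2) * (1793 / 32 + 704) / (16 * Real.pi) * (4 * M) ^ 2 * (L : ℝ) ^ 2 := by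
      rw [hNg]; field_simp
    rw [h2] at h1
    have h3 : 0 ≤ (32 * Real.pi) ^ 2 * (2 + 12 / s₁) ^ 2 * (7 * (1 + (720 * B) ^ 2)) * (L : ℝ) ^ 2 := by positivity
    calc (32 * Real.pi) ^ 2 * ((4 + 2 * Real.pi / s₀) * (2 + 12 / s₁) ^ 2) *
          (((2 * (2 * M) : ℕ) : ℝ) * (L : ℝ) ^ 2 * ((Nsupp : ℝ) * (7 * (1 + (720 * B) ^ 2))))
        = (32 * Real.pi) ^ 2 * (2 + 12 / s₁) ^ 2 * (7 * (1 + (720 * B) ^ 2)) * (L : ℝ) ^ 2 *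
            ((4 + 2 * Real.pi / s₀) * (((2 * (2 * M) : ℕ) : ℝ) * (Nsupp : ℝ))) := by ring
      _ ≤ (32 * Real.pi) ^ 2 * (2 + 12 / s₁) ^ 2 * (7 * (1 + (720 * B) ^ 2)) * (L : ℝ) ^ 2 *
            ((1 + 64 * Real.pi ^ 2) * (1793 / 32 + 704) / (16 * Real.pi) * (4 * M) ^ 2 * (L : ℝ) ^ 2) :=
          mul_le_mul_of_nonneg_left h1 h3
      _ = (32 * Real.pi) ^ 2 * (2 + 12 / s₁) ^ 2 *
            ((1 + 64 * Real.pi ^ 2) * (1793 / 32 + 704) * (7 * (1 + (720 * B) ^ 2)) / (16 * Real.pi)) * (4 * M) ^ 2 * (L : ℝ) ^ 4 := by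
          ring
  have hsqrt : Real.sqrt a * Real.sqrt b ≤ Cst * M * (L : ℝ) ^ 2 := by
    rw [← Real.sqrt_mul ha0]
    calc Real.sqrt (a * b) ≤ Real.sqrt ((Cst * M * (L : ℝ) ^ 2) ^ 2) := Real.sqrt_le_sqrt hab
      _ = Cst * M * (L : ℝ) ^ 2 := Real.sqrt_sq (by positivity)
  calc 1 / (|β| * (L : ℝ) ^ 2) * (Real.sqrt a * Real.sqrt b) ≤ 1 / (|β| * (L : ℝ) ^ 2) * (Cst * M * (L : ℝ) ^ 2) :=
        mul_le_mul_of_nonneg_left hsqrt (by positivity)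
    _ = Cst * (M / β) := by rw [abs_of_pos hβpos]; field_simp

/-- **`∃ C_T ≥ 0` packaging** (an ABSOLUTE constant: the unit-profile bound `B` of `exists_norm_iteratedDeriv_bgmCutoffSqUnit_le 6` and
`sectorCircLineConst` are fixed): under the binders above, `T_T ≤ C_T · M/β` for every sector `ω` and charge `c`.
[cite: BenfattoGiulianiMastropietro2006, Lemma 2.2 (2.36aa) and (3.3)] -/
theorem exists_timeMomentConst_klAnisoFamily_zero :
    ∃ C_T : ℝ, 0 ≤ C_T ∧ ∀ (L M : ℕ) [NeZero L] [NeZero M] (R : RenConsts) (U : ℝ) (N : ℕ) (μ : ℝ) (K : TrigPolyC4v),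
      FrameOK R U N μ K → (∀ j, 0 ≤ R.Gfr j) → μ ∈ klWindowC → 16 / 15 * (R.Gfr 0 * |U|) ≤ 1 / 50 → (2 : ℝ) ^ 15 ≤ L →
      ∀ β : ℝ, klBetaMin ≤ β → β ≤ M → klE0 * β ≤ Real.pi * (2 * M - 13) →
      ∀ (ω : Fin (sectorCount 0)) (c : Fin 2),
        1 / (|β| * (L : ℝ) ^ 2) *
            ∑ dw : TorusSite 1 (2 * (2 * M)) × TorusSite 2 L,
              (β / (2 * (2 * M) : ℕ) * cyclicDist (2 * (2 * M)) (dw.1 0) 0) *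
                ‖∑ k : FreqMomentum L M, klAnisoFamily L M β μ K klE0 0 ω k *
                  (if c = 0 then torusChar (fun _ : Fin 1 => ((k.1 : ℕ) : ZMod (2 * (2 * M)))) dw.1 * torusChar k.2 dw.2
                    else conj (torusChar (fun _ : Fin 1 => ((k.1 : ℕ) : ZMod (2 * (2 * M)))) dw.1 * torusChar k.2 dw.2))‖ ≤
          C_T * (M / β) := by
  have he : (0 : ℝ) < klE0 := by norm_num [klE0]
  obtain ⟨B, hB1, hB⟩ := exists_norm_iteratedDeriv_bgmCutoffSqUnit_le he 6
  refine ⟨128 * Real.pi * (2 + 6 * Real.pi * ((22484224 / 9 + 7180 / 3 * sectorCircLineConst) + 1)) *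
      Real.sqrt ((1 + 64 * Real.pi ^ 2) * (1793 / 32 + 704) * (7 * (1 + (720 * B) ^ 2)) / (16 * Real.pi)), ?_, ?_⟩
  · have hBc := sectorCircLineConst_nonneg
    positivity
  · intro L M _ _ R U N μ K hK hR hμ hκU hL β hβ hβM hMβ ω c
    exact timeMoment_klAnisoFamily_zero_le_explicit hK hR hμ hκU hL hβ hβM hMβ hB1 hB ω c

end Summit.HubbardSuperconductivity.HubbardSuperconductivity.Theorems.EngineV8

end
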